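import Summits.BirchSwinnertonDyer.BirchSwinnertonDyer.Theorems.ByReductionTypeAtTwoSupersingularSharpTwo
import Summits.BirchSwinnertonDyer.Rank1Residual.P2.EmptyCellsAtTwo
import Summits.BirchSwinnertonDyer.Rank1Residual.X1.EisensteinSqueeze
import Literature.NumberTheory.EllipticCurves.ComplexMultiplication
import Literature.NumberTheory.EllipticCurves.IwasawaAlgebraMuVanishingProofs
import Literature.NumberTheory.EllipticCurves.Kobayashi2003.SignedSelmerModuleFiniteProofs
import HarnessLib

/-!
# Route `ThetaPartnerAtTwo`, crux K2 `SignedMainConjectureCMTwo` (item stmt-BirchSwinnertonDyer-20307):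
# RANK-ZERO RIGIDITY — at a curve with `L(A,1) ≠ 0` and BSD₂ known, ONE divisibility at `2` is the
# whole `+` main conjecture at `2`, and `μ⁺ = 0` is then the ANALYTIC `μ`

HONEST FRAMING (cell `pub/bsd-wall`, W-ALL row 1, prover seat `bsd-wall-tp2-p2`, successor g1): the
crux (Pollack–Rubin 2004 Thm. 7.3 ported to `p = 2` + `μ⁺ = 0`, for every CM `A/ℚ` good supersingular
at `2` with `a₂ = 0`) is NOT in print at `2` and is NOT proved here (siblings: p509213, p510617,
p511378). This file (route-independent: no `Theses` module is imported) reduces the crux AT A CURVE OF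
ANALYTIC RANK `0` — the only case the route's deciding theorem `closes` uses (rev 7: the CM partner
carries `A.analyticRank = 0`; sibling `…RankZeroSuffices.lean`) — to ONE divisibility + the analytic `μ`:
* §1 (`Λ`-algebra, any `p`): if `g·h = Φ` (resp. `g = Φ·h`) in `ℚ_p⟦T⟧`, `g, h ∈ Λ`, `Φ(0) ≠ 0` and
  `ord_p g(0) = ord_p Φ(0)`, then `h ∈ Λˣ` (Washington §7.1) and `(g) = (g')` with `ι g' = Φ` EXACTLY.
* §2 (`p = 2`; `W` good ss at `2`, `a₂ = 0`, `L(W,1) ≠ 0`; GZK, `BSDp W 2`, Kim's control term at `2` as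
  binders): by the `T = 0` identity `ord₂ g(0) = ord₂ L(W,1)/Ω_W` (sibling p509213 §4, re-derived in §0)
  and `(ϖ·L♭)(0) = L(W,1)/Ω_W` (`c♭ = 1`, Sprung), the Eisenstein half `ι g = ϖ·ι(L♭·h)` (shape of the
  tree's `KobayashiLowerDivisibility W 2 1`) ALONE yields the full conclusion `char X⁺ = (g')`,
  `ι g' = ϖ·ι L♭` (the Kato half `ι(g·h) = ϖ·ι L♭` likewise, by §1). Circular for non-CM `W` (BSD₂ is
  the goal), but for CM `A` of analytic rank `0` BSD₂(A) is IN PRINT (Burungale–Flach 2024).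
* §3 (any `p`): `char M = (g)`, `ι g = ϖ·ι L`, `ord_p ϖ = 0`, some coefficient of `L` a unit ⇒
  `μ(M) = 0` (tree theorem `muInvariant_eq_zero_iff_exists_isUnit_coeff_of_charIdeal_eq_span`).
* §4 `signedMainConjectureCMTwo_at_rankZero_of_lowerDivisibility`: CM `A`, `a₂ = 0`, good ss at `2`,
  `A.analyticRank = 0`: PUB (Burungale–Flach, modularity, GZK, by name) + (T2) torsion of every signed
  dual datum of `A` + (K4c) Kim's control term at `2` for `A` + (E) `KobayashiLowerDivisibility A 2 1`
  + (μ_an) `ord₂ ϖ_A = 0 ∧ L♭_A has a unit coefficient` ⇒ `KobayashiMainConjecture A 2 1` and, at every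
  NORMALISED cyclotomic pair (`IsCyclotomicVariable 2 γ`), `X⁺` torsion with `μ⁺ = 0`. Passing to ALL
  top-generator pairs (the crux's first conjunct) is the signed copy of the tree's
  `IwasawaGeneratorChangeProofs` (unsigned: torsion-ness / `μ = 0` independent of `(κ, γ)`), not in
  the tree — a stub of the crux's skeleton, not claimed here.
So at rank `0`, K2 = (T2)_A + (K4c)_A + ONE divisibility for `A` at inert `2` + analytic `μ(L♭_A) = 0`
(KO2006 Rem. 0.2(3) for `X₀(27)`; kit j273215: `μ♭ = 0` on 25 CM anchors) + generator change; the second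
divisibility / `λ`-comparison of Pollack–Rubin's proof is NOT needed (BSD₂(A) pins the constant term).
Nothing about any curve is asserted; every research input is a displayed binder.

References: [PollackRubin2004] Thm. 7.3; [Kobayashi2003] Thm. 1.2, (3.6), Conj. p. 2; [BDKim2013] Cor. 3.15;
[BurungaleFlach2024] Thm. 1.1; [Sprung2017] Thm. 1.12, Cor. 4.4; [Washington1997] §7.1, §13.2;
[GreenbergVatsal2000] p. 2; [KuriharaOtsuki2006] Rem. 0.2 (3); [Miller2011LMS] Def. 1.1.
-/

set_option autoImplicit false
-- the Theorems namespace of this sub repeats the summit name by design (D-0017 nested layout)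
set_option linter.dupNamespace false

noncomputable section

open scoped Classical MatrixGroups ModularForm

open CongruenceSubgroup WeierstrassCurve Literature.NumberTheory.EllipticCurves
  Literature.NumberTheory.EllipticCurves.ModularForms Literature.NumberTheory.EllipticCurves.Sprung2017
  Literature.NumberTheory.EllipticCurves.Rank1Residual Literature.NumberTheory.EllipticCurves.Rank1Residual.Typed
  Literature.NumberTheory.EllipticCurves.Kobayashi2003 ZpExtension
  Summit.BirchSwinnertonDyer.Rank1Residual Summit.BirchSwinnertonDyer.Rank1Residual.Supersingular

namespace Summit.BirchSwinnertonDyer.BirchSwinnertonDyer.Theorems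

/-! ## §0. The `T = 0` valuation identity (route-independent private copy of p509213 §4) -/

section TrivialCharacter
variable (A : WeierstrassCurve ℚ) [A.IsElliptic] [A.IsGloballyMinimal]

/-- `ord₂ g(0) = ord₂ L(E,1)/Ω_E` from BSD₂ + GZK + Kim's control term at `2` (good supersingular at `2`,
`L(E,1) ≠ 0`, `D` a f.g. torsion dual datum of `Sel⁺(E/ℚ_∞)`, `g` a generator of `char X⁺`): the
statement and proof of `valuation_constantCoeff_generator_eq_of_bsdp_two` (sibling p509213, which sits
in the route's cone), repeated privately so that this file imports no route module.
[cite: BDKim2013, Cor. 3.15 (p. 199; p odd in print)] [cite: Miller2011LMS, Def. 1.1] -/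
private theorem valuation_constantCoeff_generator_aux
    (hGZK : rank_eq_analyticRank_of_analyticRank_le_one)
    (hss : GoodSS A 2) (hL : A.entireLFunction 1 ≠ 0) (hBSD : BSDp A 2)
    (hKim : ∀ (κ : ZpExtension ℚ 2) (γ : Field.absoluteGaloisGroup ℚ),
      κ.IsCyclotomic → κ.IsTopGenerator γ →
      ∀ (D : SignedSelmerDualData A κ γ 1) [Module.Finite (IwasawaAlgebra 2) D.X],
        Module.IsTorsion (IwasawaAlgebra 2) D.X →
      ∀ g : IwasawaAlgebra 2, D.charIdeal = Ideal.span {g} → Finite (A.selmerGroupPInfty 2) →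
        ∃ u : ℤ_[2]ˣ, ((PowerSeries.constantCoeff g : ℤ_[2]) : ℚ_[2]) =
          ((u : ℤ_[2]) : ℚ_[2]) * ((2 : ℕ) : ℚ_[2]) ^ (padicValNat 2 A.tamagawaProduct) *
            (Nat.card (A.selmerGroupPInfty 2) : ℚ_[2]))
    {κ : ZpExtension ℚ 2} {γ : Field.absoluteGaloisGroup ℚ} (hκ : κ.IsCyclotomic)
    (hγ : κ.IsTopGenerator γ) (D : SignedSelmerDualData A κ γ 1)
    [Module.Finite (IwasawaAlgebra 2) D.X] (hTors : Module.IsTorsion (IwasawaAlgebra 2) D.X)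
    {g : IwasawaAlgebra 2} (hchar : D.charIdeal = Ideal.span {g})
    {t : ℚ} (ht : A.entireLFunction 1 / (A.realPeriodRat : ℂ) = (t : ℂ)) :
    ((PowerSeries.constantCoeff g : ℤ_[2]) : ℚ_[2]) ≠ 0 ∧
      (((PowerSeries.constantCoeff g : ℤ_[2]) : ℚ_[2])).valuation = padicValRat 2 t := by
  have hr : A.analyticRank = 0 := analyticRank_eq_zero_of_entireLFunction_one_ne_zero A hL
  have hirr : A.HasIrreducibleModPGaloisRep 2 := P2.irr_two_of_goodSS_two A hss
  have hΩ : (A.realPeriodRat : ℂ) ≠ 0 := Complex.ofReal_ne_zero.mpr A.realPeriodRat_pos_holds.ne'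
  have ht0 : t ≠ 0 := by
    rintro rfl
    apply hL
    have h := ht
    rw [div_eq_iff hΩ] at h
    rw [h]
    simp
  have hK : (⟨g, 0, 0⟩ : SignedDatum A 2).EulerCharacteristic := fun hfin ↦
    hKim κ γ hκ hγ D hTors g hchar hfin
  obtain ⟨hne, hvg⟩ := valuation_constantCoeff_xi A 2 hGZK hL ⟨g, 0, 0⟩ hK
  haveI : Finite A.sha := (hGZK A (by omega)).2
  obtain ⟨q, hq, hv⟩ := missingPPartAt_of_bsdp A 2 hBSD
  have hsha := shaAn_eq_of_analyticRank_eq_zero A hGZK hr ht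
  have hqt : q = t * (A.torsionOrder : ℚ) ^ 2 / (A.tamagawaProduct : ℚ) := by
    have h := hq.symm.trans hsha
    exact_mod_cast h
  rw [hqt, padicValRat_shaAn_witness A 2 hirr ht0] at hv
  refine ⟨hne, ?_⟩
  rw [hvg]
  linarith
end TrivialCharacter

/-! ## §1. `Λ`-algebra: a divisibility whose two sides have the same constant-term valuation is an
equality of principal ideals -/

section Algebra
variable {p : ℕ} [Fact p.Prime]

/-- **A cofactor with unit constant term.** If `g·h ∈ Λ = ℤ_p⟦T⟧` maps to `Φ ∈ ℚ_p⟦T⟧` with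
`Φ(0) ≠ 0` and `ord_p g(0) = ord_p Φ(0)`, then `ord_p h(0) = 0`, so `h` is a unit of `Λ` (a power
series over `ℤ_p` is a unit iff its constant term is: Washington §7.1,
`X1.EisensteinSqueeze.isUnit_of_valuation_constantCoeff_eq_zero`). [cite: Washington1997, §7.1] -/
theorem isUnit_cofactor_of_valuation_constantCoeff_eq {g h : IwasawaAlgebra p}
    {Φ : PowerSeries ℚ_[p]} (hgh : iwasawaToPowerSeries p (g * h) = Φ)
    (hΦ0 : PowerSeries.constantCoeff Φ ≠ 0)
    (hval : ((PowerSeries.constantCoeff g : ℤ_[p]) : ℚ_[p]).valuation =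
      (PowerSeries.constantCoeff Φ).valuation) :
    IsUnit h := by
  have hc := congrArg PowerSeries.constantCoeff hgh
  rw [constantCoeff_iwasawaToPowerSeries, map_mul, PadicInt.coe_mul] at hc
  have hg0 : PowerSeries.constantCoeff g ≠ 0 := by
    intro h0
    apply hΦ0
    rw [← hc, h0, PadicInt.coe_zero, zero_mul]
  have hh0 : PowerSeries.constantCoeff h ≠ 0 := by
    intro h0
    apply hΦ0
    rw [← hc, h0, PadicInt.coe_zero, mul_zero]
  have hv := congrArg Padic.valuation hc
  rw [Padic.valuation_mul (PadicInt.coe_ne_zero.mpr hg0) (PadicInt.coe_ne_zero.mpr hh0), hval] at hv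
  have hvh : ((PowerSeries.constantCoeff h : ℤ_[p]) : ℚ_[p]).valuation = 0 := by linarith
  exact X1.EisensteinSqueeze.isUnit_of_valuation_constantCoeff_eq_zero hh0 hvh

/-- **One divisibility + matching constant terms = equality (upper / Kato direction).** If `I = (g)`,
`ι(g·h) = Φ`, `Φ(0) ≠ 0` and `ord_p g(0) = ord_p Φ(0)`, then `I = (g')` for some `g' ∈ Λ` with
`ι g' = Φ` exactly (`g' = g·h`, `h ∈ Λˣ`). [cite: Washington1997, §7.1] -/
theorem exists_generator_eq_of_mul_eq_of_valuation_constantCoeff_eq {I : Ideal (IwasawaAlgebra p)}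
    {g h : IwasawaAlgebra p} (hI : I = Ideal.span {g})
    {Φ : PowerSeries ℚ_[p]} (hgh : iwasawaToPowerSeries p (g * h) = Φ)
    (hΦ0 : PowerSeries.constantCoeff Φ ≠ 0)
    (hval : ((PowerSeries.constantCoeff g : ℤ_[p]) : ℚ_[p]).valuation =
      (PowerSeries.constantCoeff Φ).valuation) :
    ∃ g' : IwasawaAlgebra p, I = Ideal.span {g'} ∧ iwasawaToPowerSeries p g' = Φ := by
  have hu := isUnit_cofactor_of_valuation_constantCoeff_eq hgh hΦ0 hval
  refine ⟨g * h, ?_, hgh⟩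
  rw [hI, Ideal.span_singleton_mul_right_unit hu]

/-- **One divisibility + matching constant terms = equality (lower / Eisenstein direction).** If
`I = (g)`, `ι g = Φ · ι h`, `g(0) ≠ 0` and `ord_p g(0) = ord_p Φ(0)`, then `I = (g')` with `ι g' = Φ`
exactly (`g' = g·h⁻¹`, `h ∈ Λˣ`). [cite: Washington1997, §7.1] -/
theorem exists_generator_eq_of_eq_mul_of_valuation_constantCoeff_eq {I : Ideal (IwasawaAlgebra p)}
    {g h : IwasawaAlgebra p} (hI : I = Ideal.span {g})
    {Φ : PowerSeries ℚ_[p]} (hg : iwasawaToPowerSeries p g = Φ * iwasawaToPowerSeries p h)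
    (hg0 : PowerSeries.constantCoeff g ≠ 0)
    (hval : ((PowerSeries.constantCoeff g : ℤ_[p]) : ℚ_[p]).valuation =
      (PowerSeries.constantCoeff Φ).valuation) :
    ∃ g' : IwasawaAlgebra p, I = Ideal.span {g'} ∧ iwasawaToPowerSeries p g' = Φ := by
  -- constant terms: `g(0) = Φ(0) · h(0)`
  have hc := congrArg PowerSeries.constantCoeff hg
  rw [constantCoeff_iwasawaToPowerSeries, map_mul, constantCoeff_iwasawaToPowerSeries] at hc
  have hg0' : ((PowerSeries.constantCoeff g : ℤ_[p]) : ℚ_[p]) ≠ 0 := PadicInt.coe_ne_zero.mpr hg0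
  have hΦ0 : PowerSeries.constantCoeff Φ ≠ 0 := by
    intro h0
    exact hg0' (by rw [hc, h0, zero_mul])
  have hh0 : PowerSeries.constantCoeff h ≠ 0 := by
    intro h0
    exact hg0' (by rw [hc, h0, PadicInt.coe_zero, mul_zero])
  have hv := congrArg Padic.valuation hc
  rw [Padic.valuation_mul hΦ0 (PadicInt.coe_ne_zero.mpr hh0), hval] at hv
  have hvh : ((PowerSeries.constantCoeff h : ℤ_[p]) : ℚ_[p]).valuation = 0 := by linarith
  have hu : IsUnit h := X1.EisensteinSqueeze.isUnit_of_valuation_constantCoeff_eq_zero hh0 hvh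
  obtain ⟨u, rfl⟩ := hu
  refine ⟨g * ↑u⁻¹, ?_, ?_⟩
  · rw [hI, Ideal.span_singleton_mul_right_unit (u⁻¹).isUnit]
  · rw [map_mul, hg, mul_assoc, ← map_mul, Units.mul_inv, map_one, mul_one]
end Algebra

/-! ## §2. At a curve with `L(E,1) ≠ 0`: BSD₂ + Kim's control at `2` + ONE divisibility ⇒ the
conclusion of the `+` main conjecture at `2`, EXACT -/

section OneDivisibility
variable (A : WeierstrassCurve ℚ) [A.IsElliptic] [A.IsGloballyMinimal]

/-- The constant term of the Néron-normalised `+` function at `2`: for a newform `f` of `W` (good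
reduction at `2`, `a₂ = 0`) with period ratio `ϖ` and ANY Pollack pair `(L⁺, L⁻)` at `2` (at `a₂ = 0`
a Pollack pair is a Sprung pair, `isSprungPair_zero_iff`, so `L⁻ = L♭` has `L♭(0) = c♭·[0]⁺_f` with
`c♭ = −a₂² + 2a₂ + 1 = 1`, `constantCoeff_flat_two_of_isSprungPair_of_isNewformOf`):
`(ϖ · ι L⁻)(0) = ϖ·[0]⁺_f` in `ℚ₂`, and `L(W,1)/Ω_W = ϖ·[0]⁺_f`. [cite: Sprung2017, Thm. 1.12 and Cor. 4.4]
[cite: Kobayashi2003, (3.6) (p. 7)] -/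
theorem constantCoeff_neronPlus_two_eq {N : ℕ} [NeZero N] {f : CuspForm (Gamma0 N) 2}
    (hf : IsNewformOf A f) (hgood : A.HasGoodReductionAtPrime 2) (ha : A.frobeniusTrace 2 = 0)
    {ϖ : ℚ} (hϖ : (ϖ : ℝ) * A.realPeriodRat = plusPeriod f)
    {Lplus Lminus : IwasawaAlgebra 2} (hPP : IsPollackPair f 2 Lplus Lminus) :
    PowerSeries.constantCoeff (PowerSeries.C (ϖ : ℚ_[2]) *
        iwasawaToPowerSeries 2 (kobayashiL 1 Lplus Lminus)) =
      ((ϖ * ratPlusSymbol f 0 : ℚ) : ℚ_[2]) ∧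
    A.entireLFunction 1 / (A.realPeriodRat : ℂ) = ((ϖ * ratPlusSymbol f 0 : ℚ) : ℂ) := by
  have hΩpos : 0 < A.realPeriodRat := A.realPeriodRat_pos_holds
  have hkL : kobayashiL (1 : ℤˣ) Lplus Lminus = Lminus := by unfold kobayashiL; rw [if_pos rfl]
  have hSP : IsSprungPair f 2 (A.frobeniusTrace 2) Lplus Lminus := by
    rw [ha]
    exact (isSprungPair_zero_iff f 2 Lplus Lminus).mpr ⟨hPP.2.2.1, hPP.2.2.2⟩
  have hLf0 := constantCoeff_flat_two_of_isSprungPair_of_isNewformOf hf hgood hSP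
  rw [ha] at hLf0
  refine ⟨?_, ?_⟩
  · rw [map_mul, PowerSeries.constantCoeff_C, constantCoeff_iwasawaToPowerSeries, hkL, hLf0]
    push_cast
    ring
  · have hLval : A.entireLFunction 1 = (((ratPlusSymbol f 0 : ℝ) * plusPeriod f : ℝ) : ℂ) :=
      hf.entireLFunction_one_eq
    rw [hLval, ← hϖ, div_eq_iff (Complex.ofReal_ne_zero.mpr hΩpos.ne')]
    push_cast
    ring

/-- **The conclusion of the `+` main conjecture at `2` from its EISENSTEIN HALF, at a curve with
`L(W,1) ≠ 0` and BSD₂ known.** `W` globally minimal, good supersingular at `2`, `a₂ = 0`,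
`L(W,1) ≠ 0`; grant GZK (`hGZK`, PUB), `BSDp W 2` (`hBSD`) and Kim's control term at `2` (`hKim`,
research binder, verbatim the door's); let `(κ, γ)` be cyclotomic with a top generator, `D` a f.g.
torsion dual datum of `Sel⁺(W/ℚ_∞)`, `f` a newform of `W` with period ratio `ϖ`, `(L⁺, L⁻)` a Pollack
pair at `2`, and `char X⁺ = (g)` with `ι g = ϖ·ι(L⁻·h)` (the body of `KobayashiLowerDivisibility W 2 1`
at these data). Then `char X⁺ = (g')` with `ι g' = ϖ·ι L⁻` — the body of `KobayashiMainConjecture W 2 1`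
at these data (`ord₂ g(0) = ord₂ t = ord₂ (ϖ·L⁻)(0)`, `t = L(W,1)/Ω_W`: §0, `constantCoeff_neronPlus_two_eq`,
§1). [cite: Kobayashi2003, Conjecture (p. 2) and (3.6)]
[cite: BDKim2013, Cor. 3.15 (p odd in print)] [cite: Miller2011LMS, Def. 1.1] -/
theorem kobayashiMainConjecture_two_one_conclusion_of_lowerDivisibility
    (hGZK : rank_eq_analyticRank_of_analyticRank_le_one)
    (hss : GoodSS A 2) (ha : A.frobeniusTrace 2 = 0) (hL : A.entireLFunction 1 ≠ 0)
    (hBSD : BSDp A 2)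
    (hKim : ∀ (κ : ZpExtension ℚ 2) (γ : Field.absoluteGaloisGroup ℚ),
      κ.IsCyclotomic → κ.IsTopGenerator γ →
      ∀ (D : SignedSelmerDualData A κ γ 1) [Module.Finite (IwasawaAlgebra 2) D.X],
        Module.IsTorsion (IwasawaAlgebra 2) D.X →
      ∀ g : IwasawaAlgebra 2, D.charIdeal = Ideal.span {g} → Finite (A.selmerGroupPInfty 2) →
        ∃ u : ℤ_[2]ˣ, ((PowerSeries.constantCoeff g : ℤ_[2]) : ℚ_[2]) =
          ((u : ℤ_[2]) : ℚ_[2]) * ((2 : ℕ) : ℚ_[2]) ^ (padicValNat 2 A.tamagawaProduct) *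
            (Nat.card (A.selmerGroupPInfty 2) : ℚ_[2]))
    {κ : ZpExtension ℚ 2} {γ : Field.absoluteGaloisGroup ℚ} (hκ : κ.IsCyclotomic)
    (hγ : κ.IsTopGenerator γ) (D : SignedSelmerDualData A κ γ 1)
    [Module.Finite (IwasawaAlgebra 2) D.X] (hTors : Module.IsTorsion (IwasawaAlgebra 2) D.X)
    [NeZero (A.conductorNorm ℤ)] {f : CuspForm (Gamma0 (A.conductorNorm ℤ)) 2} (hf : IsNewformOf A f)
    {ϖ : ℚ} (hϖ : (ϖ : ℝ) * A.realPeriodRat = plusPeriod f)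
    {Lplus Lminus : IwasawaAlgebra 2} (hPP : IsPollackPair f 2 Lplus Lminus)
    {g h : IwasawaAlgebra 2} (hchar : D.charIdeal = Ideal.span {g})
    (hdiv : iwasawaToPowerSeries 2 g =
      PowerSeries.C (ϖ : ℚ_[2]) * iwasawaToPowerSeries 2 (kobayashiL 1 Lplus Lminus * h)) :
    ∃ g' : IwasawaAlgebra 2, D.charIdeal = Ideal.span {g'} ∧
      iwasawaToPowerSeries 2 g' =
        PowerSeries.C (ϖ : ℚ_[2]) * iwasawaToPowerSeries 2 (kobayashiL 1 Lplus Lminus) := by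
  obtain ⟨hΦ0, ht⟩ := constantCoeff_neronPlus_two_eq A hf hss.1 ha hϖ hPP
  set Φ := PowerSeries.C (ϖ : ℚ_[2]) * iwasawaToPowerSeries 2 (kobayashiL 1 Lplus Lminus) with hΦ
  -- `ord₂ g(0) = ord₂ t`, `t = ϖ·[0]⁺_f = L(A,1)/Ω_A` (BSD₂ + Kim + GZK, sibling file §4)
  obtain ⟨hg0, hval⟩ := valuation_constantCoeff_generator_aux A hGZK hss hL hBSD hKim hκ hγ D hTors hchar ht
  have hval' : ((PowerSeries.constantCoeff g : ℤ_[2]) : ℚ_[2]).valuation =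
      (PowerSeries.constantCoeff Φ).valuation := by
    rw [hval, hΦ0, Padic.valuation_ratCast]
  have hg : iwasawaToPowerSeries 2 g = Φ * iwasawaToPowerSeries 2 h := by
    rw [hdiv, map_mul, hΦ, mul_assoc]
  exact exists_generator_eq_of_eq_mul_of_valuation_constantCoeff_eq hchar hg
    (PadicInt.coe_ne_zero.mp hg0) hval'
end OneDivisibility

/-! ## §3. `μ = 0` from the main-conjecture identity and the analytic `μ` -/

section Mu
variable {p : ℕ} [Fact p.Prime]

/-- If `ι g = ϖ · ι L` in `ℚ_p⟦T⟧` with `ϖ ∈ ℚ`, `ord_p ϖ = 0`, and the `n`-th coefficient of `L` is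
a `p`-adic unit, then so is the `n`-th coefficient of `g` (`|g_n| = |ϖ|·|L_n| = 1`).
[cite: Washington1997, §7.1] -/
theorem isUnit_coeff_of_map_eq_C_mul {g L : IwasawaAlgebra p} {ϖ : ℚ} (hϖ0 : ϖ ≠ 0)
    (hϖ : padicValRat p ϖ = 0)
    (hg : iwasawaToPowerSeries p g = PowerSeries.C (ϖ : ℚ_[p]) * iwasawaToPowerSeries p L)
    {n : ℕ} (hn : IsUnit (PowerSeries.coeff n L)) : IsUnit (PowerSeries.coeff n g) := by
  have hc := congrArg (PowerSeries.coeff n) hg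
  rw [PowerSeries.coeff_map, PowerSeries.coeff_C_mul, PowerSeries.coeff_map] at hc
  have hϖQ : (ϖ : ℚ_[p]) ≠ 0 := by exact_mod_cast hϖ0
  have hnormϖ : ‖(ϖ : ℚ_[p])‖ = 1 := by
    rw [Padic.norm_eq_zpow_neg_valuation hϖQ, Padic.valuation_ratCast, hϖ, neg_zero, zpow_zero]
  rw [PadicInt.isUnit_iff] at hn ⊢
  rw [PadicInt.norm_def] at hn ⊢
  change ‖(algebraMap ℤ_[p] ℚ_[p]) (PowerSeries.coeff n g)‖ = 1
  rw [hc, norm_mul, hnormϖ, one_mul]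
  exact hn

/-- **`μ(M) = 0` from a main-conjecture identity with analytic `μ = 0`.** For a finitely generated
torsion `Λ`-module `M` with `char M = (g)`, `ι g = ϖ·ι L`, `ϖ ∈ ℚˣ` a `p`-adic unit and some
coefficient of `L` a unit: `μ(M) = 0` (Greenberg–Vatsal p. 2: `p^μ` is the exact power of `p` dividing
a characteristic power series; tree theorem
`muInvariant_eq_zero_iff_exists_isUnit_coeff_of_charIdeal_eq_span`). [cite: GreenbergVatsal2000, p. 2, (1)–(2)]
[cite: Washington1997, §13.2] -/
theorem muInvariant_eq_zero_of_generator_map_eq_C_mul (M : Type*) [AddCommGroup M]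
    [Module (IwasawaAlgebra p) M] [Module.Finite (IwasawaAlgebra p) M]
    (hM : Module.IsTorsion (IwasawaAlgebra p) M) {g : IwasawaAlgebra p}
    (hchar : Literature.NumberTheory.EllipticCurves.Module.charIdeal (IwasawaAlgebra p) M = Ideal.span {g})
    {ϖ : ℚ} (hϖ0 : ϖ ≠ 0) (hϖ : padicValRat p ϖ = 0) {L : IwasawaAlgebra p}
    (hL : ∃ n : ℕ, IsUnit (PowerSeries.coeff n L))
    (hg : iwasawaToPowerSeries p g = PowerSeries.C (ϖ : ℚ_[p]) * iwasawaToPowerSeries p L) :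
    muInvariant p M = 0 := by
  rw [muInvariant_eq_zero_iff_exists_isUnit_coeff_of_charIdeal_eq_span M hM hchar]
  obtain ⟨n, hn⟩ := hL
  exact ⟨n, isUnit_coeff_of_map_eq_C_mul hϖ0 hϖ hg hn⟩
end Mu

/-! ## §4. Crux K2 at a CM curve of analytic rank `0`, at the normalised cyclotomic pairs, from
torsion + Kim's control at `2` + the Eisenstein half `KobayashiLowerDivisibility A 2 1` + the analytic `μ` -/

section RankZeroCM
variable (A : WeierstrassCurve ℚ) [A.IsElliptic] [A.IsGloballyMinimal]

/-- **Crux K2 at a CM curve of analytic rank `0`, at the normalised pairs, from its Eisenstein half.**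
Let `A/ℚ` (globally minimal) be CM, good supersingular at `2`, `a₂ = 0`, `A.analyticRank = 0`. Grant,
BY NAME, the published inputs Burungale–Flach 2024 (`hBF`: BSD for CM curves with `L(E,1) ≠ 0` at
every prime), modularity (`hmod`, `hLrat`) and GZK (`hGZK`); and, READ FOR `A`, the `p = 2` research
binders (T2) `hT2`: every dual datum of `Sel⁺(A/ℚ_∞)` is `Λ`-torsion (Kobayashi Thm. 1.2 torsion half
at `2`), (K4c) `hKim`: Kim's control term at `2` (verbatim crux K4c's conjunct 2 for `A`), (E)
`hlow : KobayashiLowerDivisibility A 2 1` (the tree's typed Eisenstein half), and the analytic input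
(μ_an) `hμan`: for every newform/period-ratio/Pollack-pair datum of `A` at `2`, `ord₂ ϖ = 0` and `L⁻`
has a unit coefficient. THEN: `KobayashiMainConjecture A 2 1` (from (T2)+(K4c)+(E) by
`kobayashiMainConjecture_two_one_conclusion_of_lowerDivisibility`, BSD₂(A) from `hBF`), and for every
cyclotomic `κ`, top generator `γ` with `IsCyclotomicVariable 2 γ` and every `D`: `X⁺` torsion and
`μ⁺ = 0` (§3 at the modular-parametrisation newform, `ϖ > 0`, Sprung's pair
`exists_isPollackPair_two`). The crux's first conjunct WITHOUT `IsCyclotomicVariable` is not concluded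
here (signed generator change, see the module docstring). Nothing asserted beyond the binders.
[cite: BurungaleFlach2024, Thm. 1.1] [cite: Kobayashi2003, Thm. 1.2 and Conjecture (p. 2)]
[cite: BDKim2013, Cor. 3.15 (p odd in print)] [cite: PollackRubin2004, Thm. 7.3 (p > 2 in print)] -/
theorem signedMainConjectureCMTwo_at_rankZero_of_lowerDivisibility
    (hBF : bsdTriple_of_hasCM_of_L_one_ne_zero)
    (hmod : nonempty_modularParametrizationData) (hLrat : hasEntireLFunction_rat)
    (hGZK : rank_eq_analyticRank_of_analyticRank_le_one)
    (hcm : A.HasCM) (hss : GoodSS A 2) (ha : A.frobeniusTrace 2 = 0) (hr : A.analyticRank = 0)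
    (hT2 : ∀ (κ : ZpExtension ℚ 2) (γ : Field.absoluteGaloisGroup ℚ),
      κ.IsCyclotomic → κ.IsTopGenerator γ →
      ∀ D : SignedSelmerDualData A κ γ 1, Module.IsTorsion (IwasawaAlgebra 2) D.X)
    (hKim : ∀ (κ : ZpExtension ℚ 2) (γ : Field.absoluteGaloisGroup ℚ),
      κ.IsCyclotomic → κ.IsTopGenerator γ →
      ∀ (D : SignedSelmerDualData A κ γ 1) [Module.Finite (IwasawaAlgebra 2) D.X],
        Module.IsTorsion (IwasawaAlgebra 2) D.X →
      ∀ g : IwasawaAlgebra 2, D.charIdeal = Ideal.span {g} → Finite (A.selmerGroupPInfty 2) →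
        ∃ u : ℤ_[2]ˣ, ((PowerSeries.constantCoeff g : ℤ_[2]) : ℚ_[2]) =
          ((u : ℤ_[2]) : ℚ_[2]) * ((2 : ℕ) : ℚ_[2]) ^ (padicValNat 2 A.tamagawaProduct) *
            (Nat.card (A.selmerGroupPInfty 2) : ℚ_[2]))
    (hlow : KobayashiLowerDivisibility A 2 1)
    (hμan : ∀ [NeZero (A.conductorNorm ℤ)] (f : CuspForm (Gamma0 (A.conductorNorm ℤ)) 2),
      IsNewformOf A f → ∀ (ϖ : ℚ), (ϖ : ℝ) * A.realPeriodRat = plusPeriod f →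
      ∀ (Lplus Lminus : IwasawaAlgebra 2), IsPollackPair f 2 Lplus Lminus →
        padicValRat 2 ϖ = 0 ∧ ∃ n : ℕ, IsUnit (PowerSeries.coeff n (kobayashiL 1 Lplus Lminus))) :
    KobayashiMainConjecture A 2 1 ∧
    ∀ (κ : ZpExtension ℚ 2) (γ : Field.absoluteGaloisGroup ℚ),
      κ.IsCyclotomic → κ.IsTopGenerator γ → IsCyclotomicVariable 2 γ →
      ∀ D : SignedSelmerDualData A κ γ 1, Module.IsTorsion (IwasawaAlgebra 2) D.X ∧ D.mu = 0 := by
  have hL : A.entireLFunction 1 ≠ 0 := (A.analyticRank_eq_zero_iff_holds (hLrat A)).mp hr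
  have hBSD : BSDp A 2 :=
    forall_bsdp_of_bsdTriple A A.tamagawaProduct_pos_holds (hBF A hcm hL) 2 Nat.prime_two
  have hMC : KobayashiMainConjecture A 2 1 := by
    intro κ γ hκ hγ hγ' _ f hf ϖ hϖ Lplus Lminus hPP D
    haveI := Kobayashi2003.SignedSelmerDualData.moduleFinite hγ D
    have hTors := hT2 κ γ hκ hγ D
    obtain ⟨g, h, hchar, hdiv⟩ := hlow κ γ hκ hγ hγ' f hf ϖ hϖ Lplus Lminus hPP D
    exact ⟨hTors, kobayashiMainConjecture_two_one_conclusion_of_lowerDivisibility A hGZK hss ha hL hBSD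
      hKim hκ hγ D hTors hf hϖ hPP hchar hdiv⟩
  refine ⟨hMC, fun κ γ hκ hγ hγ' D => ?_⟩
  haveI := Kobayashi2003.SignedSelmerDualData.moduleFinite hγ D
  have hTors := hT2 κ γ hκ hγ D
  refine ⟨hTors, ?_⟩
  -- a newform datum (modularity), its period ratio `ϖ > 0`, a Pollack pair at `2` (needs `L(A,1) ≠ 0`)
  haveI : NeZero (A.conductorNorm ℤ) := ⟨(A.conductorNorm_pos_holds).ne'⟩
  obtain ⟨Dm⟩ := hmod A
  obtain ⟨ϖ, hϖpos, hϖeq, -⟩ := Dm.exists_rat_mul_realPeriodRat_eq_plusPeriod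
  obtain ⟨Ls, Lf, -, hPP⟩ := exists_isPollackPair_two Dm.isNewformOf hss.1 ha hL
  obtain ⟨-, g, hchar, hg⟩ := hMC κ γ hκ hγ hγ' Dm.f Dm.isNewformOf ϖ hϖeq Ls Lf hPP D
  obtain ⟨hϖv, hμ⟩ := hμan Dm.f Dm.isNewformOf ϖ hϖeq Ls Lf hPP
  exact muInvariant_eq_zero_of_generator_map_eq_C_mul D.X hTors hchar hϖpos.ne' hϖv hμ hg
end RankZeroCM

end Summit.BirchSwinnertonDyer.BirchSwinnertonDyer.Theorems

end
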